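import Summits.Ventures.CertifiedManyBodySolver.Downfold.TAxisSeam
import Summits.Ventures.CertifiedManyBodySolver.Downfold.S2Seam
import Literature.MathematicalPhysics.QuantumLattice.HubbardTTPrimeThermalAnnexOfBoxWords
import HarnessLib

/-!
# The THERMAL ANNEX seam: EVERY typed `T = 0` cell word `[F, C]` is a typed T-axis word `[F, C + 1.3863·kT₂/t₁]` at physical temperature
# (hubbard-box-p2's `thermalWindow_of_constWord_Icc₃_decimal` read through `TAxisSeam` on a one-band box)

Venture CertifiedManyBodySolver, cell `pub/hubbard-downfold` (stage S1 ↔ S2 seam, D-0099 T axis), seat hubbard-downfold-mod-1; namespace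
`Summit.Ventures.CertifiedManyBodySolver.Downfold`. hubbard-box-p2's `Literature/…/HubbardTTPrimeThermalAnnexOfBoxWords.lean` (p538105; pointer
hubbard-fast-surrogate-1 INBOX 2026-08-27T18:07:01Z): a two-sided `T = 0` word `F ≤ e₀(t, θ 1, θ 0, θ 2) ≤ C` on a cell `Set.Icc ![U₁, s₁, n₁] ![U₂, s₂, n₂]`
(`0 ≤ U₁`, `0 ≤ n₁`, `n₂ < 2`) gives, for every `β ≥ β₀ > 0` and every torus-limit canonical-SECTOR Gibbs state at `(β, t, θ 1, θ 0, θ 2)`: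
`F ≤ e(ω) ≤ C + 1.3863/β₀` (ground-state floor ⊕ the Gibbs variational principle with the entropy bound `2·H_b(n/2) ≤ log 4 ≤ 1.3863`).
This file is the ONE generic adapter that types it: on a one-band box `B` with entries `eU, eS, eN, eT` (`0 ≤ U/t`, `0 ≤ n < 2`, `0 < t₁ = eT.encl.fst`),
a `T = 0` word on the delivered cell `Set.Icc (s2Lo eU eS eN) (s2Hi eU eS eN)` yields, for every temperature cell `Θ = [kT₁, kT₂]` (eV, `0 < kT₁`) and every
`kT ∈ Θ`: at every member `p`, every `β' ≥ p t_eV/kT`, every torus-limit sector-Gibbs state of `H(1, p tp/t, p U/t)` at `β'`, filling `p n`: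
**`e(ω) ∈ [F, C + 1.3863/β̃₀]`, `β̃₀ = t₁/kT₂`** (`holdsOn_thermalAnnex_of_cellWord`; `…_of_le` with any `c ≥ C + 1.3863/β̃₀`).
CONSEQUENCE: every typed box that carries a `T = 0` energy word — closed (hypothesis-free sandwich / AF-chord / polrow words) or conditional — now carries a
typed T-axis word at every map temperature with NO thermal certificate at all; for the closed words the T-axis word is HYPOTHESIS-FREE
(`BoxesThermalAnnexClosed.lean`). Where cold-ray words exist (cell #1, the electron-doped M cells) they are tighter below ≈ 500 K; the annex is the
universal fallback (slack `1.3863·kT₂/t₁`: 0.106 t at 300 K for `t₁ = 0.34` eV, 0.035 t at 100 K).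
HONEST FRAMING: energy windows for torus limits of canonical-sector Gibbs states (density-keyed; not GC/μ-keyed), in units of the member's `t`; the
`T = 0` word's hypotheses (if any) are carried unchanged; the box is a modelling frame (`B.Mem p`); nothing here is a phase sentence, an order word or a
`T_c`. Everything is PROVED; no definition, no `sorry`.
-/

noncomputable section

namespace Summit.Ventures.CertifiedManyBodySolver.Downfold

open NonemptyInterval Literature.MathematicalPhysics.QuantumLattice
  Literature.MathematicalPhysics.QuantumLattice.ThermodynamicLimit
  Literature.MathematicalPhysics.QuantumLattice.InfVolFermionState
  Literature.Probability.LatticeModels _root_.Filter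

open scoped ComplexOrder

/-- **THE THERMAL ANNEX SEAM.** One-band box `B` with entries `eU, eS, eN, eT` (`0 ≤ eU.lo`, `0 ≤ eN.lo`, `eN.hi < 2`, `0 < t₁ = eT.lo`); a `T = 0` word
`F ≤ e₀(1, θ 1, θ 0, θ 2) ≤ C` on the delivered cell; a temperature cell `Θ = [kT₁, kT₂]` with `0 < kT₁`. Then for every `kT ∈ Θ`, on `B`: for every
`β' ≥ p t_eV/kT` and every torus-limit sector-Gibbs state `ω` of `H(1, p tp/t, p U/t)` at `β'`, filling `p n`: `e(ω) ∈ [F, C + 1.3863/(t₁/kT₂)]`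
(box-p2's `thermalWindow_of_constWord_Icc₃_decimal` at `β₀ = t₁/kT₂ ≤ p t_eV/kT ≤ β'`). [cite: Israel1979, Thm. I.3.4] [cite: Ruelle1969, §2.5–2.6] -/
theorem holdsOn_thermalAnnex_of_cellWord {B : OneBandBox} {eU eS eN eT : Entry}
    (hU : B .UOverT = some eU) (hS : B .tpOverT = some eS) (hN : B .filling = some eN) (hT : B .tEV = some eT)
    (hU0 : (0 : ℚ) ≤ eU.encl.fst) (hn0 : (0 : ℚ) ≤ eN.encl.fst) (hn2 : eN.encl.snd < 2) {t₁ : ℚ} (ht : eT.encl.fst = t₁) (ht0 : 0 < t₁)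
    {F C : ℝ}
    (hW : ∀ θ ∈ Set.Icc (s2Lo eU eS eN) (s2Hi eU eS eN),
      F ≤ energyDensityTT' 1 (θ 1) (θ 0) (θ 2) ∧ energyDensityTT' 1 (θ 1) (θ 0) (θ 2) ≤ C)
    {Θ : NonemptyInterval ℚ} (hΘ : 0 < Θ.fst) {kT : ℝ} (hk : kT ∈ Θ.ratCast ℝ) :
    HoldsOn (fun p : OneBandCoord → ℝ => ∀ β' : ℝ, p .tEV / kT ≤ β' →
      ∀ (ω : InfVolFermionState 2) (Ls : ℕ → ℕ), Tendsto Ls atTop atTop →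
        ω.IsTorusLimitOfMixture (sectorGibbsCount (p .filling))
          (fun L => sectorGibbsWeightTT' β' 1 (p .tpOverT) (p .UOverT) (p .filling) L)
          (fun L => sectorGibbsVectorTT' 1 (p .tpOverT) (p .UOverT) (p .filling) L) Ls →
        ω.meanEnergy (hubbardTTPrimeFermionInteraction 1 (p .tpOverT) (p .UOverT)) 1 ∈
          Set.Icc F (C + 1.3863 / (((t₁ / Θ.snd : ℚ)) : ℝ))) B := by
  intro p hp β' hβ' ω Ls hLs hω
  have hΘ2 : (0 : ℚ) < Θ.snd := lt_of_lt_of_le hΘ Θ.fst_le_snd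
  have hβ0 : (0 : ℝ) < (((t₁ / Θ.snd : ℚ)) : ℝ) := by exact_mod_cast div_pos ht0 hΘ2
  have hle : (((t₁ / Θ.snd : ℚ)) : ℝ) ≤ β' := by
    have h1 := ends_div_le_div hΘ (show (0 : ℚ) ≤ eT.encl.fst by rw [ht]; exact ht0.le) (hp _ _ hT) hk
    rw [ht] at h1
    exact le_trans h1 hβ'
  have hθ := s2Coords_mem_Icc hU hS hN hp
  have hU1 : (0 : ℝ) ≤ ((eU.encl.fst : ℚ) : ℝ) := by exact_mod_cast hU0
  have hn1 : (0 : ℝ) ≤ ((eN.encl.fst : ℚ) : ℝ) := by exact_mod_cast hn0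
  have hn2' : ((eN.encl.snd : ℚ) : ℝ) < 2 := by exact_mod_cast hn2
  have main := thermalWindow_of_constWord_Icc₃_decimal (t := 1) (U₁ := ((eU.encl.fst : ℚ) : ℝ)) (s₁ := ((eS.encl.fst : ℚ) : ℝ))
    (n₁ := ((eN.encl.fst : ℚ) : ℝ)) (U₂ := ((eU.encl.snd : ℚ) : ℝ)) (s₂ := ((eS.encl.snd : ℚ) : ℝ)) (n₂ := ((eN.encl.snd : ℚ) : ℝ))
    hU1 hn1 hn2' hW hβ0 β' hle (s2Coords p) hθ ω Ls hLs
  simp only [s2Coords, Matrix.cons_val_zero, Matrix.cons_val_one, Matrix.cons_val_two] at main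
  exact main hω

/-- **… with any larger printed cap**: if `C + 1.3863/(t₁/kT₂) ≤ c` then `e(ω) ∈ [F, c]` on `B` (same quantifiers). [cite: Israel1979, Thm. I.3.4] -/
theorem holdsOn_thermalAnnex_of_cellWord_of_le {B : OneBandBox} {eU eS eN eT : Entry}
    (hU : B .UOverT = some eU) (hS : B .tpOverT = some eS) (hN : B .filling = some eN) (hT : B .tEV = some eT)
    (hU0 : (0 : ℚ) ≤ eU.encl.fst) (hn0 : (0 : ℚ) ≤ eN.encl.fst) (hn2 : eN.encl.snd < 2) {t₁ : ℚ} (ht : eT.encl.fst = t₁) (ht0 : 0 < t₁)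
    {F C : ℝ}
    (hW : ∀ θ ∈ Set.Icc (s2Lo eU eS eN) (s2Hi eU eS eN),
      F ≤ energyDensityTT' 1 (θ 1) (θ 0) (θ 2) ∧ energyDensityTT' 1 (θ 1) (θ 0) (θ 2) ≤ C)
    {Θ : NonemptyInterval ℚ} (hΘ : 0 < Θ.fst) {c : ℝ} (hc : C + 1.3863 / (((t₁ / Θ.snd : ℚ)) : ℝ) ≤ c)
    {kT : ℝ} (hk : kT ∈ Θ.ratCast ℝ) :
    HoldsOn (fun p : OneBandCoord → ℝ => ∀ β' : ℝ, p .tEV / kT ≤ β' →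
      ∀ (ω : InfVolFermionState 2) (Ls : ℕ → ℕ), Tendsto Ls atTop atTop →
        ω.IsTorusLimitOfMixture (sectorGibbsCount (p .filling))
          (fun L => sectorGibbsWeightTT' β' 1 (p .tpOverT) (p .UOverT) (p .filling) L)
          (fun L => sectorGibbsVectorTT' 1 (p .tpOverT) (p .UOverT) (p .filling) L) Ls →
        ω.meanEnergy (hubbardTTPrimeFermionInteraction 1 (p .tpOverT) (p .UOverT)) 1 ∈ Set.Icc F c) B :=
  fun p hp β' hβ' ω Ls hLs hω =>
    have h := holdsOn_thermalAnnex_of_cellWord hU hS hN hT hU0 hn0 hn2 ht ht0 hW hΘ hk p hp β' hβ' ω Ls hLs hω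
    ⟨h.1, h.2.trans hc⟩

end Summit.Ventures.CertifiedManyBodySolver.Downfold

end
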